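import Summits.CriticalPhenomena.CardyFormulaZ2.Theses.CardyMagicRigidity
import Literature.Probability.RandomPlanarGeometry.NestingTransform
import Literature.Probability.Percolation.FullPlaneCNL
import Literature.Barriers.CriticalPhenomena.NestingTransformBlindness

/-!
# Skeleton line `markov-cascade-one-generation` for crux `NestingRigidity` (stmt-CriticalPhenomena-4835)

Route `CardyMagicRigidity`, crux r3 `NestingRigidity` ≡ `MagicFormulaZ2 → MagicFormulaT → LoopLimitZ2EqT`
(literally, `Iff.rfl`; refuter rreview d82cb032).  As a `Prop` the crux is implied by the target `X =
LoopLimitZ2EqT` alone, so the whole value of a skeleton is the INTENDED PROOF it names; every stub below is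
typed so that it is (a) a genuine theorem-to-prove of the line and (b) true in the believed world (each
conclusion is a consequence of bond-ℤ² ~ site-𝕋 universality in domains), hence attackable only through its
intended mechanism — which the line card states stub by stub.

## The line (idea card `Ideas/markov-cascade-one-generation.md`, crux-ideate r1 ideator 1; triage r1: 3 × pass)

LEVER: `IsInterfaceLoop ω γ` (resp. `IsSiteInterfaceLoop ω γ`) reads `ω` only on the edges listed in `γ`
(resp. on the sites bordering the darts of `γ`), so "`γ` is an interface loop" is a cylinder event on `γ`'s
own edges/sites and, under the product measure, inside and outside are conditionally independent given it;
with `∫ f = 0` and nested-or-disjoint interiors every loop NOT inside `γ` weighs `2cos(π/3) = 1`.  Hence the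
exact ONE-GENERATION FACTORISATION on both lattices (`stub_oneGenerationZ2`, `stub_oneGenerationT`: lattice
theorems, no hypothesis of the crux) and the disintegration `Λ_δ(f) = E[M_{ℓ̃_R}(f)] + (no-loop error)` of
the full-plane transform into CONDITIONAL (wired-domain) transforms.  The crux is then cut, in RELATIVE
LATTICE CLOTHING (bond-ℤ² at mesh `δ` against site-𝕋 at mesh `δ`, no continuum object in any statement,
exactly as the route types `X`), along the Markov cascade of CLOSED-boundary-condition domain ensembles
`domLoopsZ2 U δ ω = bondLoopConfig δ 0 (ω ∩ meshEdges U δ)`, `domLoopsT U δ ω = siteLoopConfig δ (ω ∩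
triMeshVertices U δ)` (all of `U`ᶜ closed — the ensemble Camia–Newman explore, `CLE6.lean`'s
`triLoopCollection` convention):

* `stub_deAveraging` (XL, LOAD-BEARING, rank 1): both magic formulas (+ the two factorisations) ⇒ the
  closed-b.c. DOMAIN transforms of the two lattices merge, `M^{ℤ²}_{U_δ,δ}(f) − M^{𝕋}_{U_δ,δ}(f) → 0`, for the
  winding interiors `U_δ = holeOf (u_δ)` of every family of loops `u_δ → u` (in the loop metric of `d_CN`)
  with a TWO-SIDED limit loop `u` (every trace point accumulated by interior and exterior: Jordan curves,
  CLE₆-type pinched loops; no retraced arcs) and every admissible `f` compactly supported in `holeOf u`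
  (`DomainTransfer`).  Domains are indexed by LOOPS because the holes of the cascade are exactly winding
  interiors of (lattice, then continuum-pinched) loops.  This is the card's honest gap "DE-AVERAGING" typed as
  the first stub after (2c), as triage r1-3 asked; route (b) of the card (boundary-blind atoms) is dead
  (triage r1-1 F3), route (a) (outside positive-cone guards reweighting the law of the enclosing loop while
  the disintegration persists) is the intended mechanism; the VALUE of the domain transform is never claimed
  (F3: it carries a `log CR` drift, no domain magic formula is known) — only the ℤ²/𝕋 merger.
* `stub_kernelUniqueness` (XL⁻, rank 2): merged domain transforms for ALL such domains ⇒ merged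
  FIRST-GENERATION KERNELS `Q_D` = laws of the outermost loops (`firstGen`) of the closed-b.c. ensembles, in
  DKKMO's `d_CN` (`KernelTransfer`).  This is the card's Transfer C⁺ (first half, "domain nesting rigidity"):
  by the one-generation identity `M_D(f) = E_{Q_D}[∏ᵢ 2cos(θ_{ℓᵢ}(f)+π/3) · M^{open}_{int ℓᵢ}(f)]` both
  kernels solve the same equations for all `f ⊂⊂ D` and all sub-domains simultaneously; the input that
  breaks the smoothing-transform degeneracy (triage r1-2 (b)) is exactly F3 turned into a resource — the hole
  transform `M_{int ℓ}(f)` HEARS THE SHAPE of the hole through its boundary (`log CR`) term — plus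
  non-crossing (holes nested-or-disjoint) taken from the lattice, never from the transform.
* `stub_cascadeReconstruction` (L, rank 3): merged kernels along all convergent loop families (continuous-
  convergence form) ⇒ merged closed-b.c. domain LAWS in balls (`DomainLawTransfer`): iterate the exact lattice Markov
  decomposition (first generation, then independent colour-swapped / dual closed-b.c. ensembles in the holes)
  to finite depth; the continuity in the ROUGH random hole that the ℤ² side cannot supply by identity
  coupling (4 alternating arms along a dimension-7/4 boundary: expected `ε^{-1/2}` near-pinchings) is taken
  from the 𝕋 side (Camia–Newman convergence in converging Jordan domains + Radó continuity of CLE₆), which is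
  why every domain statement of the line is in continuous-convergence form `u_δ → u`.
* `stub_windowLocality` (M, provable now): merged closed-b.c. laws in all balls ⇒ `X`: a full-plane loop
  inside `B(0, 1/η)` IS a loop of the closed-b.c. ensemble of `B(0, R)`, `R > 1/η + δ`, by the cylinder
  property, so the identity coupling gives `d_CN(full, ball ensemble) ≤ η` surely; then
  `cnLawEDist_triangle`.

`NestingRigidity_of` composes the six stubs into the crux BY NAME (kernel-checked, no `sorry`):
`X = windowLocality (cascadeReconstruction (kernelUniqueness (deAveraging OGF_ℤ² OGF_𝕋 MFZ2 MFT)))`.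

## Gen-2 revision (this file; gen-1 skeleton `4af5569e805e…`, 2026-08-15T23:58Z)

One change, at `domLoopsZ2`: the `ℤ²` closed-b.c. domain ensemble is RESTRICTED to the interface loops that
visit an edge of `U_δ`.  Reason (junk found by the gen-2 audit, see the docstring of `domLoopsZ2`): the
medial loop representation of `ℤ²` is fully packed, so closing the exterior edges surrounds EVERY exterior
vertex with a deterministic type-`1` diamond, while the honeycomb ensemble has no loop outside `U`; as
`LoopConfig.IsClose` has no lower diameter cut-off, every `d_CN` law comparison of the unrestricted
ensembles fails surely — `KernelTransfer` and `DomainLawTransfer` were false as typed, `stub_kernelUniqueness`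
false in the believed world and `stub_cascadeReconstruction` / `stub_windowLocality` vacuous.  With the
restriction all six statements are again consequences of `ℤ² ~ 𝕋` universality in domains; the stub set,
the signatures' shape and `NestingRigidity_of` are otherwise those of gen-1.

## Disproof used

`disproof_path` (`run/gate/evidence/stmt-CriticalPhenomena-4835/…-Disproof.lean`, cdisprove v1.1) is not
mounted in this jail (same for all three triagers); its negative lemmas LANDED as the barrier
`Literature.Barriers.CriticalPhenomena.NestingTransformBlindness` (p68977), imported below and honoured:
(i) type-blindness / (ii) null-interior blindness / (iii) covering-multiplicity blindness of `A_f` — no stub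
infers types, non-degeneracy or covering degree from transform data: `firstGen`, `domLoopsZ2/T` carry the
lattice typing and the lattice loops themselves; (iv) `hasNestingTransform_union` /
`superposition_half_variance` / `sswMGF_three_eq_six` (the conditional CLE₃ ⊔ CLE₃ impostor) — excluded at
`stub_kernelUniqueness`, whose hypothesis is not "a law with the CLE₆ transform" but the interface-Markov
one-generation identity in EVERY domain for the two Bernoulli ensembles (an independent union has no
interface-Markov property: the hidden layer crosses every interface).  No `_false_without_` theorem of the
Disproof is readable here; the recorded structural obstruction (rreview: the complex height measure has total
variation `2^{#loops}`) is honoured by never forming a complex measure — all objects are positive percolation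
laws and `d_CN`.  No `Negative/` lemma has landed for this crux (nothing to import); `ledger negatives
--problem CriticalPhenomena`: 7 entries, none on nesting transforms or domain Markov properties.
-/

noncomputable section

open MeasureTheory Set Filter
open scoped Topology BigOperators ENNReal Real

namespace Summit.CriticalPhenomena.CardyFormulaZ2.Cruxes.NestingRigidity.MarkovCascadeOneGeneration

open Literature.Probability.RandomPlanarGeometry Literature.Probability.Percolation
  Literature.Probability.LatticeModels
open Summit.CriticalPhenomena.CardyFormulaZ2.Theses.CardyMagicRigidity

/-! ### Vocabulary of the line (all over existing declarations; no `sorry`) -/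

/-- Critical bond percolation on `ℤ²` (`P_{1/2}`), the measure of `MagicFormulaZ2` / `LoopLimitZ2EqT`. -/
abbrev P2 : Measure (BondConfig (Site 2)) := bondPercolation (zdGraph 2) half

/-- Critical site percolation on `𝕋` (`P_{1/2}`), the measure of `MagicFormulaT` / `LoopLimitZ2EqT`. -/
abbrev PT : Measure (SiteConfig (Site 2)) := triSitePercolation half

/-- The crux's conclusion `X = LoopLimitZ2EqT` is about `siteLoopConfig δ` (definitional check,
`siteLoopConfig_eq`). -/
example : LoopLimitZ2EqT ↔ Tendsto (fun δ : ℝ ↦ LoopConfig.cnLawEDist P2 (bondLoopConfig δ 0) PT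
    (siteLoopConfig δ)) (𝓝[>] 0) (𝓝 0) := Iff.rfl

/-- The crux is literally `MagicFormulaZ2 → MagicFormulaT → LoopLimitZ2EqT`. -/
example : NestingRigidity ↔ (MagicFormulaZ2 → MagicFormulaT → LoopLimitZ2EqT) := Iff.rfl

/-! #### Closed-boundary-condition domain ensembles on both lattices -/

/-- The edges of `ℤ²` both of whose endpoints, drawn at mesh `δ` (`meshPoint δ`), lie in `U`. -/
def meshEdges (U : Set ℂ) (δ : ℝ) : Set (Sym2 (Site 2)) := {e | ∀ x ∈ e, meshPoint δ x ∈ U}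

/-- **Closed-b.c. domain loop ensemble on `δℤ² ∩ U`**: the typed interface loops (`loopCurve δ 0`,
DKKMO typing `loopType`, exactly as in `bondLoopConfig δ 0`) of `ω` with every edge not inside `U` declared
CLOSED (`ω ∩ meshEdges U δ`: "dual-wired" = closed boundary condition), RESTRICTED TO THE LOOPS THAT VISIT
AN EDGE OF `U_δ` (`∃ e ∈ γ, e ∈ meshEdges U δ`).

Why the restriction (gen-2 revision, the one change w.r.t. the gen-1 skeleton `4af5569e805e`).  The medial
loop representation of `ℤ²` is FULLY PACKED: closing every edge at a vertex `v` with `meshPoint δ v ∉ U`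
makes `{v}` an isolated primal cluster, and its medial diamond `[E, N, W, S]` IS an `IsInterfaceLoop` of
`ω ∩ meshEdges U δ` (four corner darts around `v`; every middle edge is closed, so `IsMedialTurn` holds
through its `v₁ = v₂` disjunct) of type `1` (counter-clockwise, `loopSignedArea > 0`).  Unrestricted,
`bondLoopConfig δ 0 (ω ∩ meshEdges U δ)` therefore carries a deterministic carpet of diameter-`δ` type-`1`
loops at EVERY exterior vertex of `ℂ ∖ U`, whereas the honeycomb ensemble `domLoopsT` has no loop farther
than `δ` from `U` (a dart of `IsSiteInterfaceLoop` needs an open site on its left).  Since DKKMO's relation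
`LoopConfig.IsClose ε` has no lower diameter cut-off (EVERY loop with trace in `B(0, 1/ε)` must be matched
within `udist ≤ ε`, same type), the carpet makes `IsClose ε` fail SURELY for bounded `U` and small `ε`:
every `d_CN` law comparison of the unrestricted domain ensembles (`KernelTransfer`, `DomainLawTransfer`
below) would be false for this trivial reason, and the stubs consuming them vacuous.  An interface loop all
of whose edges are closed turns around the same vertex at every step, i.e. it is such a diamond; so the
restriction removes exactly the exterior carpet and keeps every loop bordering an open cluster or a dual
cluster of `U_δ` — all within `δ/2` of `U`.  (On `𝕋` nothing is removed: `domLoopsT` is not fully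
packed.)  The nesting transform is unaffected (an exterior diamond weighs `2cos(π/3) = 1`).  Its outermost
loops are the exterior boundaries of the open clusters of `U_δ` visible from `∂U` (type `1`), isolated
open vertices included. -/
def domLoopsZ2 (U : Set ℂ) (δ : ℝ) (ω : BondConfig (Site 2)) : LoopConfig ℂ where
  F i := {u | ∃ (γ : List MedialVertex) (h : IsInterfaceLoop (ω ∩ meshEdges U δ) γ),
    loopType γ = i ∧ (∃ e ∈ γ, e ∈ meshEdges U δ) ∧
      u = UnbasedLoop.mk (BasedLoop.mk (loopCurve δ 0 γ) (isLoop_loopCurve δ 0 h.ne_nil))}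

/-- The restricted domain ensemble is a sub-configuration of the loop representation of the modified
configuration `ω ∩ meshEdges U δ` (same loops, same types; only the exterior diamonds are gone). -/
theorem domLoopsZ2_subset (U : Set ℂ) (δ : ℝ) (ω : BondConfig (Site 2)) (i : Fin 2) :
    (domLoopsZ2 U δ ω).F i ⊆ (bondLoopConfig δ 0 (ω ∩ meshEdges U δ)).F i := by
  rintro u ⟨γ, h, ht, -, rfl⟩
  exact ⟨γ, h, ht, rfl⟩

/-- **Closed-b.c. domain loop ensemble on `δ𝕋 ∩ U`**: the typed honeycomb interface-loop configuration
(`siteLoopConfig δ`) of `ω` with every site outside `U` declared CLOSED — verbatim the restriction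
`ω ∩ triMeshVertices U δ` of `CLE6.lean`'s `triLoopCollection` (Camia–Newman's monochromatic boundary).
No restriction is needed here: every dart of an `IsSiteInterfaceLoop` has an OPEN site on its left, and
open sites lie in `U`, so every loop borders an open cluster of `U_δ` and stays within `δ` of `U`. -/
def domLoopsT (U : Set ℂ) (δ : ℝ) (ω : SiteConfig (Site 2)) : LoopConfig ℂ :=
  siteLoopConfig δ (ω ∩ triMeshVertices U δ)

/-- The closed-b.c. DOMAIN NESTING TRANSFORM of bond-`ℤ²` in `U` at mesh `δ`:
`M^{ℤ²}_{U,δ}(f) = E_{1/2}[A_f(domLoopsZ2 U δ)]`, `A_f = ∏_u 2cos(∫_{int u} f + π/3)` (`nestingWeight`). -/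
def domTransformZ2 (U : Set ℂ) (δ : ℝ) (f : ℂ → ℝ) : ℝ := ∫ ω, (domLoopsZ2 U δ ω).nestingWeight f ∂P2

/-- The closed-b.c. domain nesting transform of site-`𝕋` in `U` at mesh `δ`. -/
def domTransformT (U : Set ℂ) (δ : ℝ) (f : ℂ → ℝ) : ℝ := ∫ ω, (domLoopsT U δ ω).nestingWeight f ∂PT

/-- **First generation** of a typed loop configuration: the outermost loops, i.e. those whose winding
interior `{W ≠ 0}` is not strictly contained in the interior of another loop of the configuration (types
kept). For the closed-b.c. domain ensembles: the exterior boundaries of the open clusters of `U_δ` visible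
from `∂U` (dual-connected, resp. closed-connected, to it), all of type `1`, isolated open vertices/sites along the closed
backbone included (micro first-generation loops: `d_CN` will ask for them too). The law of
`firstGen ∘ domLoops# U δ` is the FIRST-GENERATION KERNEL `Q^{#}_{U,δ}` of the cascade. -/
def firstGen (c : LoopConfig ℂ) : LoopConfig ℂ :=
  ⟨fun i ↦ {u ∈ c.F i | ∀ v ∈ c.loops, ¬ ({z | u.wind z ≠ 0} ⊂ {z | v.wind z ≠ 0})}⟩

/-- The (winding) INTERIOR of a loop: the open set of points of non-zero winding number — the hole a
first-generation loop leaves for the next generation (for a pinched loop: the union of its lobes; for the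
round circle: the open ball). Domains of the line are indexed by loops through `holeOf`. -/
def holeOf (u : UnbasedLoop ℂ) : Set ℂ := {z | u.wind z ≠ 0}

/-- **Two-sided loops**: every point of the trace is accumulated both by the interior `{W ≠ 0}` and by the
exterior `{W = 0} ∖ trace` — Jordan curves, and the pinched, self-touching loops of continuum percolation
(no triple points, no retraced arcs); excluded are degenerate limits (point loops, arcs traced back and
forth, interior slits), along whose approximants the two lattices resolve `δ`-thin features differently
and `d_CN`-comparisons fail for trivial reasons. The admissible LIMITS of the convergent domain families. -/
def TwoSided (u : UnbasedLoop ℂ) : Prop :=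
  u.range ⊆ closure (holeOf u) ∧ u.range ⊆ closure {z | u.wind z = 0 ∧ z ∉ u.range}

/-- Admissible test functions of the crux, localised to the interior of a loop: measurable, bounded,
supported compactly inside `holeOf u` (`tsupport f ⊆ holeOf u`; the hole is open and bounded) and neutral
(`∫ f = 0`). -/
def AdmissibleIn (u : UnbasedLoop ℂ) (f : ℂ → ℝ) : Prop :=
  Measurable f ∧ (∃ C : ℝ, ∀ z, |f z| ≤ C) ∧ tsupport f ⊆ holeOf u ∧ ∫ z, f z = 0

/-! #### One-generation vocabulary on `ℤ²` (ideator's Sketch §2, verbatim) -/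

/-- Primal edges strictly INSIDE the medial circuit `γ`: non-zero winding number of the drawn loop
`loopCurve 1 0 γ` at the edge midpoint (off the trace for `e ∉ γ`), scale-free. -/
def insideEdges (γ : List MedialVertex) : Set MedialVertex :=
  {e | (loopCurve 1 0 γ).wind (medialPoint 1 e) ≠ 0 ∧ e ∉ γ}

/-- Primal edges strictly OUTSIDE the medial circuit `γ`. -/
def outsideEdges (γ : List MedialVertex) : Set MedialVertex :=
  {e | (loopCurve 1 0 γ).wind (medialPoint 1 e) = 0 ∧ e ∉ γ}

/-- The interface loops of `δℤ²` lying inside the medial circuit `γ` (interior inside the interior of the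
drawn `γ`; `γ` itself harmlessly included, its factor being `1` when `∫ f = 0`). -/
def insideLoopsZ2 (δ : ℝ) (γ : List MedialVertex) (ω : BondConfig (Site 2)) : Set (UnbasedLoop ℂ) :=
  {u ∈ (bondLoopConfig δ 0 ω).loops | {z | u.wind z ≠ 0} ⊆ {z | (loopCurve δ 0 γ).wind z ≠ 0}}

/-- The CONDITIONAL (wired-domain) transform `M_γ(f)` on `ℤ²`: the `I_γ`-conditional expectation of the
twisted weight of the loops inside `γ` (junk `0/0 = 0` if `γ` is impossible). By the cylinder property the
conditioning only pins the states of `γ`'s own edges. -/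
def condTransformZ2 (δ : ℝ) (γ : List MedialVertex) (f : ℂ → ℝ) : ℝ :=
  (∫ ω in {ω | IsInterfaceLoop ω γ}, (∏ᶠ u ∈ insideLoopsZ2 δ γ ω, u.nestingFactor f) ∂P2) /
    (P2 {ω | IsInterfaceLoop ω γ}).toReal

/-! #### One-generation vocabulary on `𝕋` -/

/-- The sites of `𝕋` READ by `IsSiteInterfaceLoop ω γ`: the endpoints of the `𝕋`-edges crossed by the
darts of the honeycomb walk `γ` (open on the left, closed on the right). -/
def loopSitesT {v : HexVertex} (γ : hexGraph.Walk v v) : Set (Site 2) :=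
  {x | ∃ d ∈ γ.darts, ∃ e : triGraph.Dart, triEdgeFaces e = (d.snd, d.fst) ∧ (x = e.fst ∨ x = e.snd)}

/-- Sites strictly INSIDE the honeycomb circuit `γ` (non-zero winding number of `siteLoopCurve 1 γ` at the
hexagon centre `triMeshPoint 1 x`, which is off the trace) and not read by `I_γ`. -/
def insideSitesT {v : HexVertex} (γ : hexGraph.Walk v v) : Set (Site 2) :=
  {x | (siteLoopCurve 1 γ).wind (triMeshPoint 1 x) ≠ 0 ∧ x ∉ loopSitesT γ}

/-- Sites strictly OUTSIDE the honeycomb circuit `γ` and not read by `I_γ`. -/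
def outsideSitesT {v : HexVertex} (γ : hexGraph.Walk v v) : Set (Site 2) :=
  {x | (siteLoopCurve 1 γ).wind (triMeshPoint 1 x) = 0 ∧ x ∉ loopSitesT γ}

/-- The honeycomb interface loops of `δ𝕋` lying inside the circuit `γ`. -/
def insideLoopsT (δ : ℝ) {v : HexVertex} (γ : hexGraph.Walk v v) (ω : SiteConfig (Site 2)) :
    Set (UnbasedLoop ℂ) :=
  {u ∈ (siteLoopConfig δ ω).loops | {z | u.wind z ≠ 0} ⊆ {z | (siteLoopCurve δ γ).wind z ≠ 0}}

/-- The conditional (wired-domain) transform `M_γ(f)` on `𝕋`. -/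
def condTransformT (δ : ℝ) {v : HexVertex} (γ : hexGraph.Walk v v) (f : ℂ → ℝ) : ℝ :=
  (∫ ω in {ω | IsSiteInterfaceLoop ω γ}, (∏ᶠ u ∈ insideLoopsT δ γ ω, u.nestingFactor f) ∂PT) /
    (PT {ω | IsSiteInterfaceLoop ω γ}).toReal

/-! ### The six stub STATEMENTS (named `Prop`s; the registered `stub_*` theorems restate them verbatim and
`Registered.stub_*` are their name-keyed aliases, the hypotheses of `NestingRigidity_of`) -/

/-- Statement of STUB 1 — ONE-GENERATION FACTORISATION on `ℤ²` (ideator's (2c), a lattice theorem): for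
`δ > 0`, `f` carried by the interior of the drawn circuit `γ` with `∫ f = 0`, and any outside-cylinder event
`B`, `E[A_f ; I_γ ∩ B] = M_γ(f) · P(I_γ ∩ B)`. -/
def OneGenerationZ2 : Prop :=
  ∀ (δ : ℝ) (γ : List MedialVertex) (f : ℂ → ℝ) (B₀ : Set (Set MedialVertex)),
    0 < δ → (∀ z, f z ≠ 0 → (loopCurve δ 0 γ).wind z ≠ 0) → ∫ z, f z = 0 →
    MeasurableSet {ω : BondConfig (Site 2) | ω ∩ outsideEdges γ ∈ B₀} →
      ∫ ω in {ω | IsInterfaceLoop ω γ} ∩ {ω | ω ∩ outsideEdges γ ∈ B₀},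
          (bondLoopConfig δ 0 ω).nestingWeight f ∂P2 =
        condTransformZ2 δ γ f * (P2 ({ω | IsInterfaceLoop ω γ} ∩ {ω | ω ∩ outsideEdges γ ∈ B₀})).toReal

/-- Statement of STUB 2 — ONE-GENERATION FACTORISATION on `𝕋` (same identity for honeycomb circuits). -/
def OneGenerationT : Prop :=
  ∀ (δ : ℝ) (v : HexVertex) (γ : hexGraph.Walk v v) (f : ℂ → ℝ) (B₀ : Set (Set (Site 2))),
    0 < δ → (∀ z, f z ≠ 0 → (siteLoopCurve δ γ).wind z ≠ 0) → ∫ z, f z = 0 →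
    MeasurableSet {ω : SiteConfig (Site 2) | ω ∩ outsideSitesT γ ∈ B₀} →
      ∫ ω in {ω | IsSiteInterfaceLoop ω γ} ∩ {ω | ω ∩ outsideSitesT γ ∈ B₀},
          (siteLoopConfig δ ω).nestingWeight f ∂PT =
        condTransformT δ γ f * (PT ({ω | IsSiteInterfaceLoop ω γ} ∩ {ω | ω ∩ outsideSitesT γ ∈ B₀})).toReal

/-- `DomainTransfer` — the DE-AVERAGED magic formula in relative lattice clothing: along every family of
loops `u_δ → u` (loop metric of `d_CN`, two-sided limit) and for every admissible `f` compactly supported in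
`holeOf u`, the closed-b.c. domain transforms of bond-`ℤ²` and site-`𝕋` in the holes `holeOf (u_δ)` merge:
`M^{ℤ²}_{U_δ,δ}(f) − M^{𝕋}_{U_δ,δ}(f) → 0`.  (Continuous-convergence form: constant families, lattice
polygons, half-mesh shifts `u − δc` and the random holes of the cascade are the intended instances.) -/
def DomainTransfer : Prop :=
  ∀ (u : UnbasedLoop ℂ) (uδ : ℝ → UnbasedLoop ℂ), TwoSided u → Tendsto uδ (𝓝[>] 0) (𝓝 u) →
    ∀ f : ℂ → ℝ, AdmissibleIn u f →
      Tendsto (fun δ : ℝ ↦ domTransformZ2 (holeOf (uδ δ)) δ f - domTransformT (holeOf (uδ δ)) δ f)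
        (𝓝[>] 0) (𝓝 0)

/-- `KernelTransfer` — the FIRST-GENERATION KERNELS merge: along every family of loops `u_δ → u` with
two-sided limit, the laws of the outermost loops of the two closed-b.c. ensembles in the holes
`holeOf (u_δ)` become `d_CN`-indistinguishable.  `d_CN` has no lower cut-off, so the statement also asks
that the micro first-generation loops of one lattice (isolated open vertices/sites attached to the closed
backbone from `∂U`) be `ε`-shadowed by first-generation loops of the other: with the exterior carpet
removed (`domLoopsZ2`) these obligations are symmetric and hold w.h.p. by finite energy along the
backbone — the same soup-matching that makes `X = LoopLimitZ2EqT` itself meaningful. -/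
def KernelTransfer : Prop :=
  ∀ (u : UnbasedLoop ℂ) (uδ : ℝ → UnbasedLoop ℂ), TwoSided u → Tendsto uδ (𝓝[>] 0) (𝓝 u) →
    Tendsto (fun δ : ℝ ↦ LoopConfig.cnLawEDist P2 (fun ω ↦ firstGen (domLoopsZ2 (holeOf (uδ δ)) δ ω))
      PT (fun ω ↦ firstGen (domLoopsT (holeOf (uδ δ)) δ ω))) (𝓝[>] 0) (𝓝 0)

/-- `DomainLawTransfer` — closed-b.c. domain UNIVERSALITY in balls: for every `R > 0` the full closed-b.c.
loop ensembles of bond-`ℤ²` and site-`𝕋` in `B(0, R)` (all generations, boundary-touching loops and the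
micro soups of both lattices inside and along the boundary included; nothing outside `B(0, R + δ)` on
either side, by the restriction in `domLoopsZ2`) become `d_CN`-indistinguishable as `δ → 0⁺`. -/
def DomainLawTransfer : Prop :=
  ∀ R : ℝ, 0 < R → Tendsto (fun δ : ℝ ↦ LoopConfig.cnLawEDist P2 (domLoopsZ2 (Metric.ball 0 R) δ)
    PT (domLoopsT (Metric.ball 0 R) δ)) (𝓝[>] 0) (𝓝 0)

/-- Statement of STUB 3 — DE-AVERAGING (load-bearing): the two one-generation factorisations and the two
magic formulas (the crux's antecedents, in the route's own words) give `DomainTransfer`. -/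
def DeAveraging : Prop :=
  OneGenerationZ2 → OneGenerationT → MagicFormulaZ2 → MagicFormulaT → DomainTransfer

/-- Statement of STUB 4 — FIRST-GENERATION KERNEL UNIQUENESS (Transfer C⁺, first half). -/
def KernelUniqueness : Prop := DomainTransfer → KernelTransfer

/-- Statement of STUB 5 — CASCADE RECONSTRUCTION (Transfer C⁺ ⇒ domain laws). -/
def CascadeReconstruction : Prop := KernelTransfer → DomainLawTransfer

/-- Statement of STUB 6 — WINDOW LOCALITY ("free boundary = no boundary" for loops inside the window). -/
def WindowLocality : Prop := DomainLawTransfer → LoopLimitZ2EqT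

/-! ### The registered stubs -/

/-- STUB 1 (M, provable now) — `OneGenerationZ2`.  Why true: `IsInterfaceLoop ω γ` reads `ω` only at the
edges listed in `γ` (`isInterfaceLoop_iff`: `IsMedialTurn ω e₋ e e₊` reads the state of `e` alone), so
`I_γ` is a cylinder on `γ`'s edges; under the product measure `bondPercolation` (`bondPercolation_indep`)
the inside edges, `γ`'s edges and the outside edges are independent; interiors of interface loops are
nested or disjoint (non-crossing, `InterfaceLoop*` / `LoopPartnerWinding`), so with `∫ f = 0` and `f`
carried by `int γ` every loop not inside `γ` has phase `0` or `∫ f`, weight `2cos(π/3) = 1`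
(`nestingFactor_eq_one_of_nestingPhase_eq_zero`); the inside loops are a function of (inside edges, `γ`'s
edges).  Work: finiteness of the `finprod` support at fixed `δ > 0`, measurability
(`FKLoopNestingMeasurable`), the nested-or-disjoint lemma for medial circuits. -/
theorem stub_oneGenerationZ2 :
    ∀ (δ : ℝ) (γ : List MedialVertex) (f : ℂ → ℝ) (B₀ : Set (Set MedialVertex)),
      0 < δ → (∀ z, f z ≠ 0 → (loopCurve δ 0 γ).wind z ≠ 0) → ∫ z, f z = 0 →
      MeasurableSet {ω : BondConfig (Site 2) | ω ∩ outsideEdges γ ∈ B₀} →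
        ∫ ω in {ω | IsInterfaceLoop ω γ} ∩ {ω | ω ∩ outsideEdges γ ∈ B₀},
            (bondLoopConfig δ 0 ω).nestingWeight f ∂P2 =
          condTransformZ2 δ γ f *
            (P2 ({ω | IsInterfaceLoop ω γ} ∩ {ω | ω ∩ outsideEdges γ ∈ B₀})).toReal := by
  sorry

/-- STUB 2 (M, provable now) — `OneGenerationT`, the honeycomb version: `IsSiteInterfaceLoop ω γ` reads
exactly the sites `loopSitesT γ` (left site open, right site closed, dart by dart), `triSitePercolation half`
is a product of fair coins, honeycomb interface cycles are SIMPLE (`IsCycle`) so interiors are Jordan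
polygons, nested or disjoint; same computation as STUB 1 with sites for edges (simpler: no self-touching). -/
theorem stub_oneGenerationT :
    ∀ (δ : ℝ) (v : HexVertex) (γ : hexGraph.Walk v v) (f : ℂ → ℝ) (B₀ : Set (Set (Site 2))),
      0 < δ → (∀ z, f z ≠ 0 → (siteLoopCurve δ γ).wind z ≠ 0) → ∫ z, f z = 0 →
      MeasurableSet {ω : SiteConfig (Site 2) | ω ∩ outsideSitesT γ ∈ B₀} →
        ∫ ω in {ω | IsSiteInterfaceLoop ω γ} ∩ {ω | ω ∩ outsideSitesT γ ∈ B₀},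
            (siteLoopConfig δ ω).nestingWeight f ∂PT =
          condTransformT δ γ f *
            (PT ({ω | IsSiteInterfaceLoop ω γ} ∩ {ω | ω ∩ outsideSitesT γ ∈ B₀})).toReal := by
  sorry

/-- STUB 3 (XL, LOAD-BEARING, the hardest) — `DeAveraging`: from the FULL-PLANE Gaussian transform
identities on both lattices (`MagicFormulaZ2`, `MagicFormulaT`) to the merger of the closed-b.c. DOMAIN
transforms along every convergent loop family `u_δ → u` (`DomainTransfer`).  Intended mechanism (card §Why-it-bites (5), route (a)
only — route (b) "atoms are boundary blind" is refuted by triage F3): summing STUB 1 / STUB 2 over the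
outermost loop `ℓ̃_R` surrounding `supp f` inside `B(0,R)` disintegrates `Λ_δ(f) = E[M_{ℓ̃_R}(f)] +
O(P(no loop))` on each lattice; inserting outside GUARDS `g` from the positive cone (`∫(f+g) = 0`, weights
of `g`-cutting loops `≥ 0`, resonant charges `±π/6` — triage: thicken circles to annuli, charges `|·| ≤ π/6`)
keeps the disintegration exact while tilting the law of `ℓ̃_R` through an explicit, tunable family; both
lattices satisfy the same guarded identities with the same Gaussian right-hand sides, and `D ↦ M_{D,δ}(f)`
is RSW-equicontinuous on each lattice for domains far from `supp f`; the bet is that this family of averaged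
identities separates the conditional transforms.  Why it might fail: two interface-Markov cascades with
equal full-plane transforms and different domain transforms (card falsifier (1)/(3)); the averaging kernel
(law of `ℓ̃_R` given the guards) is itself lattice-dependent, so the identities are of the form
`E^{ℤ²}[M^{ℤ²} · G] = E^{𝕋}[M^{𝕋} · G] + o(1)` with two unknowns each — closing this needs a bootstrap over
scales (the de-averaged identity at scale `r` feeds the law of `ℓ̃` at scale `R`). -/
theorem stub_deAveraging :
    OneGenerationZ2 → OneGenerationT → MagicFormulaZ2 → MagicFormulaT → DomainTransfer := by
  sorry

/-- STUB 4 (XL⁻) — `KernelUniqueness`: merged closed-b.c. domain transforms in the holes of ALL convergent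
loop families and all admissible `f` ⇒ merged first-generation kernels in `d_CN` along the same families
(`DomainTransfer → KernelTransfer`).  Intended mechanism (Transfer C⁺ of the card, first half): pass to
subsequential limits along `u_δ → u` (Aizenman–Burchard tightness of interface loops on both lattices; on `𝕋` the limit kernel is
CLE₆'s by Camia–Newman); by STUBS 1–2 summed over first generations, both limit kernels `Q, Q'` satisfy
`E_Q[Ψ_f] = E_{Q'}[Ψ_f]` for all `f ⊂⊂ D`, `Ψ_f(ℓ₁, ℓ₂, …) = ∏ᵢ 2cos(θ_{ℓᵢ}(f) + π/3) · M^{open}_{int ℓᵢ}(f)`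
with the SAME hole transforms (merged by hypothesis, open b.c. = colour-swap / planar dual of closed b.c.);
small-amplitude and multi-bump expansions of `λ ↦ Ψ_{λf}` read off mixed moments of the phases AND of the
boundary terms of the hole transforms, which depend on the hole through `log CR(z; hole)`-type quantities
(triage F3: `M_{B(x,r₂+η)}(f)/Λ(f) ~ (η/r₂)^{λ/2π}`) — the first generation is HEARD through its holes; the
law of the random field `z ↦ CR(z, hole(z))` determines the holes, and non-crossing (holes nested-or-
disjoint, from the lattice) turns holes back into loops.  No template: the κ = 4 analogue (ASW two-valued
sets) uses an honest field and `cos`, not `2cos` (triage r1-2 (a)); here no complex measure is formed.  Why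
it might fail: dark directions — first-generation statistics invisible to every `Ψ_f` (e.g. how holes of ONE
pinched loop differ from holes of two touching loops is seen only through the non-linearity
`2cos(θ₁+θ₂+π/3) ≠ ∏ 2cos(θᵢ+π/3)`); the expansion needs the second-order structure of the (unknown) CLE₆
domain transform. -/
theorem stub_kernelUniqueness : DomainTransfer → KernelTransfer := by
  sorry

/-- STUB 5 (L) — `CascadeReconstruction`: merged first-generation kernels along every convergent loop
family ⇒ merged closed-b.c. domain laws in every ball (`KernelTransfer → DomainLawTransfer`; the ball is
`holeOf` of the round circle, a two-sided loop, constant family).  Mechanism: the exact lattice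
MARKOV DECOMPOSITION on both lattices (multi-loop form of STUBS 1–2: given the first generation `(ℓᵢ)`, the
configurations in the holes are independent percolations with the loop's own edges/sites pinned; inside a
type-1 loop the ensemble is the TYPE-SWAP of a closed-b.c. ensemble — exact colour symmetry of
`triSitePercolation half`, planar self-duality of bond-`ℤ²` at `1/2` with the half-mesh shift `δ(1+i)/2`,
absorbed by the families `u_δ − δc → u`; the hole of a medial loop `γ`, read on faces, is exactly
`meshVertices (holeOf γ − δc) δ`, vertex-induced); iterate to finite depth (the number of generations carrying a
loop of diameter `≥ η` inside `B(0,R)` is tight, BKKKW/RSW); couple generation by generation with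
`cnLawEDist_triangle`: ℤ² in its hole `H^{ℤ²}` vs 𝕋 in the SAME hole (hypothesis, upgraded from continuous
convergence to uniformity over the precompact family of hole loops — AB regularity; limits of lattice
holes are two-sided a.s.: no retraced arcs, a 6-arm/AB estimate) vs 𝕋 in its own
`ε`-close hole `H^{𝕋}` (continuity in law on the 𝕋 side: Camia–Newman convergence in converging Jordan
domains, CMP 268 Thm 5 / PTRF 139, + Radó continuity of CLE₆ + its Markov property).  Why it might fail /
the work: holes of bond-`ℤ²` medial loops are PINCHED (self-touching at bridges) — components are Jordan,
ensembles in different components independent; microscopic first-generation loops must be matched too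
(`d_CN` has no lower cut-off: finite-energy density of isolated sites along the closed boundary cluster);
the 𝕋-side uniformity over converging domains must be vendored (Camia–Newman's Theorem for `(D_δ,·) → (D,·)`);
and, below every scale, the soup bookkeeping that `d_CN` demands (every micro-loop of either ball ensemble
inside the window — isolated vertices/sites, faces, boundary-attached micro-loops — is `ε`-shadowed by a
same-type loop of the other w.h.p.; finite energy, union bound over `(R/ε)²` boxes). -/
theorem stub_cascadeReconstruction : KernelTransfer → DomainLawTransfer := by
  sorry

/-- STUB 6 (M, provable now) — `WindowLocality`: closed-b.c. universality in all balls ⇒ `X`.  Proof: by the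
cylinder property (ideator's (2a) `isInterfaceLoop_congr_of_agree`; site version: `I_γ` reads `loopSitesT γ`
only) a loop of the full-plane configuration whose trace lies in `B(0, 1/η)` — the only loops `IsClose η`
constrains are those with `range ⊆ B(0, 1/η)` — is a loop, of the same type, of the closed-b.c. ensemble of
`B(0, R)` as soon as `R > 1/η + δ` (its edges lie within `δ/2` of its trace, hence in `meshEdges`, so it
passes the restriction of `domLoopsZ2`), and conversely; so the identity coupling gives
`IsClose η (bondLoopConfig δ 0 ω) (domLoopsZ2 (ball 0 R) δ ω)` surely (a.e.: `ω ⊆ E(ℤ²)`), whence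
`cnLawEDist ≤ η` (`cnLawEDist_le_of_coupling`), same on `𝕋`; conclude with `cnLawEDist_triangle` (standard
Borel: `standardBorelSpace_siteConfig` and its bond analogue; measurable exceptional events:
`measurableSet_isClose_of_gen` with `gen_siteLoopConfig` and a bond analogue). -/
theorem stub_windowLocality : DomainLawTransfer → LoopLimitZ2EqT := by
  sorry

/-! ### Consistency: each named statement IS its registered stub (definitionally) -/

theorem oneGenerationZ2_holds : OneGenerationZ2 := stub_oneGenerationZ2
theorem oneGenerationT_holds : OneGenerationT := stub_oneGenerationT
theorem deAveraging_holds : DeAveraging := stub_deAveraging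
theorem kernelUniqueness_holds : KernelUniqueness := stub_kernelUniqueness
theorem cascadeReconstruction_holds : CascadeReconstruction := stub_cascadeReconstruction
theorem windowLocality_holds : WindowLocality := stub_windowLocality

/-! ### Name-keyed aliases of the six statements (the hypotheses of the composition)

`Registered.stub_X` is statement `X` under the registered stub's short name, so that the native skeleton
audit (`#h21_check_skeleton`: hypotheses admissible iff registered obligations / declared stubs BY NAME)
accepts `NestingRigidity_of : Registered.stub_oneGenerationZ2 → … → NestingRigidity` (same device as
`Cruxes/LagHandOff/Lines/crosscut-dictionary.lean`). -/
namespace Registered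

/-- Alias of `OneGenerationZ2` keyed by the registered stub name. -/
abbrev stub_oneGenerationZ2 : Prop := OneGenerationZ2
/-- Alias of `OneGenerationT` keyed by the registered stub name. -/
abbrev stub_oneGenerationT : Prop := OneGenerationT
/-- Alias of `DeAveraging` keyed by the registered stub name. -/
abbrev stub_deAveraging : Prop := DeAveraging
/-- Alias of `KernelUniqueness` keyed by the registered stub name. -/
abbrev stub_kernelUniqueness : Prop := KernelUniqueness
/-- Alias of `CascadeReconstruction` keyed by the registered stub name. -/
abbrev stub_cascadeReconstruction : Prop := CascadeReconstruction
/-- Alias of `WindowLocality` keyed by the registered stub name. -/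
abbrev stub_windowLocality : Prop := WindowLocality

end Registered

/-! ### The composition: the six stubs imply the crux, by name -/

/-- `NestingRigidity` from the six stub STATEMENTS (pure logic, no `sorry`): given the crux's
antecedents `MagicFormulaZ2`, `MagicFormulaT`, STUB 3 (fed by STUBS 1–2) de-averages them into
`DomainTransfer`, STUB 4 turns merged domain transforms into merged first-generation kernels, STUB 5
rebuilds merged closed-b.c. laws in balls, STUB 6 removes the boundary: `X = LoopLimitZ2EqT`.
Hypothesis form (statements keyed by the registered stub names). -/
theorem nestingRigidity_of_stubs (h1 : Registered.stub_oneGenerationZ2)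
    (h2 : Registered.stub_oneGenerationT) (h3 : Registered.stub_deAveraging)
    (h4 : Registered.stub_kernelUniqueness) (h5 : Registered.stub_cascadeReconstruction)
    (h6 : Registered.stub_windowLocality) :
    Summit.CriticalPhenomena.CardyFormulaZ2.Theses.CardyMagicRigidity.NestingRigidity := by
  intro hZ2 hT
  exact h6 (h5 (h4 (h3 h1 h2 hZ2 hT)))

/-- **The crux BY NAME from the registered stubs** (lead reshape, gen-1 seat -1): the only `sorry`s in
the cone of this theorem are the six registered `stub_*` theorems above; when the last of them is
closed this theorem closes `Summit.CriticalPhenomena.CardyFormulaZ2.Theses.CardyMagicRigidity.NestingRigidity`. -/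
theorem NestingRigidity_of :
    Summit.CriticalPhenomena.CardyFormulaZ2.Theses.CardyMagicRigidity.NestingRigidity :=
  nestingRigidity_of_stubs stub_oneGenerationZ2 stub_oneGenerationT stub_deAveraging
    stub_kernelUniqueness stub_cascadeReconstruction stub_windowLocality

/-- Barrier import check (Disproof used): the landed negative content for this crux is the barrier
`NestingTransformBlindness`, proved in the tree; no stub above is an instance of its refuted principles
(transform data alone ⇒ `d_CN`-identification). -/
example : Literature.Barriers.CriticalPhenomena.NestingTransformBlindness :=
  Literature.Barriers.CriticalPhenomena.nestingTransformBlindness_holds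

end Summit.CriticalPhenomena.CardyFormulaZ2.Cruxes.NestingRigidity.MarkovCascadeOneGeneration

end
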